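import Mathlib
import Literature.AlgebraicGeometry.Resolution.CobordantGame
import Literature.AlgebraicGeometry.Resolution.CobordantChartOneMove
import Summits.ResolutionOfSingularities.ResolutionOfSingularities.Theorems.WeightedInvariantLocalWeightedDropSigmaEmbedding
import Summits.ResolutionOfSingularities.ResolutionOfSingularities.Theorems.WeightedInvariantLocalWeightedDropTwistedTrivialWitnesses
import Summits.ResolutionOfSingularities.ResolutionOfSingularities.Theorems.WeightedInvariantLocalWeightedDropOffVertexConeWin
import Summits.ResolutionOfSingularities.ResolutionOfSingularities.Theorems.WeightedInvariantLocalWeightedDropG5MoveOne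

/-!
# `WeightedInvariant.LocalWeightedDrop`: the honest 5-variable wild specimen `g₅` is WON in two moves (§4 R2-4)

Route `ResolutionOfSingularities/WeightedInvariant`, crux `LocalWeightedDrop`
(stmt-ResolutionOfSingularities-8899).  [OURS · L1 W4.3] — §4 R2-4 `won_g5` of ideator res-L1-w43-idea-1's
`Sketch-L1-idea-1.lean` (v4): card A WINS `g₅ = X² + uZ⁴ + u³S⁴ + S t³` in two moves, char `2`, EVERY field of characteristic
`2` (the sketch's `[IsAlgClosed k]` is not needed).  Nothing here is a statement of the manuscript under review on ladder
RESOLUTION; AI-produced, weaker than expert review.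

MOVE TWO.  By `…G5MoveOne` the singular successors of the first move are `G_γ = X² + uZ⁴ + u³(γ+S)⁴ + (γ+S)t³ ∈
k⟦s, X, u, Z, S, t⟧`, `γ ≠ 0`.  In characteristic `2`, with `β = γ + S` and `W = β²u + Z²`,
`uZ⁴ + u³β⁴ = u·W²`, `u = β⁻²(W + Z²)`, `X² + β⁻²Z²W² = (X + β⁻¹ZW)²`, so `G_γ = (X + β⁻¹ZW)² + β t³ + β⁻²W³`.  With a cube
root `μ ∈ k⟦S⟧`, `μ³ = β/γ` (Hensel, `3 ∈ k×`), the formal coordinate change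
`θ₂ : X ↦ X + γ⁻¹μ⁻¹·Z·V,  u ↦ γ⁻²μ⁻⁴·V + γ⁻²μ⁻⁶·Z²,  t ↦ μ⁻¹·t` (identity on `s, Z, S`; `V` in the `u`-slot) gives
EXACTLY the polynomial `G_γ ∘ θ₂ = X² + γ⁻²V³ + γ t³` (`exists_moveTwo_g5Successor`: the move is legal — linear part
`diag(1,1,γ⁻²,1,1,1)` — and the identity holds), which is `(X:3, V:2, t:2)`-homogeneous of degree `6` with affine cone smooth
off the vertex directions (`3 ∈ k×`); the off-vertex one-move win (`…OffVertexConeWin`) finishes.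

* `embAt` — embedding `k⟦T⟧ → k⟦x₀..x_{N-1}⟧` along a chosen variable (generalises `embσ` of `…SigmaEmbedding`);
  `coeff_single_one_mul_X` — linear coefficients of `φ · x_v`.
* `exists_moveTwo_g5Successor`, `won_g5Successor` (every `G_γ`, `γ ≠ 0`, is won in one move), `won_g5`.
-/

set_option linter.dupNamespace false -- mandated namespace of this single-conjunct summit
set_option autoImplicit false

namespace Summit.ResolutionOfSingularities.ResolutionOfSingularities.Theorems

namespace GradedGame

open MvPowerSeries
open Literature.AlgebraicGeometry.Resolution
open Literature.AlgebraicGeometry.Resolution.CobordantChart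

variable {k : Type} [Field k]

/-! ## Embedding a one-variable series along a chosen variable -/

section EmbAt

variable {N : ℕ} (j : Fin N)

/-- Embedding of a one-variable series along the variable `X j`. [OURS · L1 W4.3] -/
noncomputable def embAt (q : PowerSeries k) : MvPowerSeries (Fin N) k :=
  PowerSeries.subst (X j : MvPowerSeries (Fin N) k) q

/-- `X j` is substitutable into a one-variable series. [OURS · L1 W4.3] -/
theorem hasSubst_Xj : PowerSeries.HasSubst (X j : MvPowerSeries (Fin N) k) :=
  PowerSeries.HasSubst.of_constantCoeff_zero (by simp [constantCoeff_X])

/-- `embAt` is multiplicative. [OURS · L1 W4.3] -/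
theorem embAt_mul (q r : PowerSeries k) : embAt j (q * r) = embAt j q * embAt j r :=
  PowerSeries.subst_mul (hasSubst_Xj j) q r

/-- `embAt` commutes with powers. [OURS · L1 W4.3] -/
theorem embAt_pow (q : PowerSeries k) (m : ℕ) : embAt j (q ^ m) = embAt j q ^ m :=
  PowerSeries.subst_pow (hasSubst_Xj j) q m

/-- `embAt` is additive. [OURS · L1 W4.3] -/
theorem embAt_add (q r : PowerSeries k) : embAt j (q + r) = embAt j q + embAt j r :=
  PowerSeries.subst_add (hasSubst_Xj j) q r

/-- `embAt (C r) = C r`. [OURS · L1 W4.3] -/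
theorem embAt_C (r : k) : embAt j (PowerSeries.C r) = C r := PowerSeries.subst_C r

/-- `embAt 1 = 1`. [OURS · L1 W4.3] -/
theorem embAt_one : embAt j (1 : PowerSeries k) = 1 := by
  rw [show (1 : PowerSeries k) = PowerSeries.C 1 from (map_one _).symm, embAt_C, map_one]

/-- `embAt T = X j`. [OURS · L1 W4.3] -/
theorem embAt_X : embAt j (PowerSeries.X : PowerSeries k) = X j := PowerSeries.subst_X (hasSubst_Xj j)

/-- Splitting off the constant term: `embAt q = X j · embAt q' + C (q 0)`. [OURS · L1 W4.3] -/
theorem embAt_eq_X_mul_add_C (q : PowerSeries k) :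
    ∃ q' : PowerSeries k, embAt j q = X j * embAt j q' + C (PowerSeries.constantCoeff q) := by
  refine ⟨PowerSeries.mk fun i => PowerSeries.coeff (i + 1) q, ?_⟩
  conv_lhs => rw [PowerSeries.eq_X_mul_shift_add_const q]
  rw [embAt_add, embAt_mul, embAt_X, embAt_C]

/-- The constant coefficient of an embedded series. [OURS · L1 W4.3] -/
theorem constantCoeff_embAt (q : PowerSeries k) : constantCoeff (embAt j q) = PowerSeries.constantCoeff q := by
  obtain ⟨q', hq'⟩ := embAt_eq_X_mul_add_C j q
  rw [hq', map_add, map_mul, constantCoeff_X, zero_mul, zero_add, constantCoeff_C]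

end EmbAt

/-- Linear coefficients of `φ · x_v`: `[i = v] · φ(0)`. [OURS · L1 W4.3] -/
theorem coeff_single_one_mul_X {N : ℕ} (φ : MvPowerSeries (Fin N) k) (v i : Fin N) :
    coeff (Finsupp.single i 1) (φ * X v) = if i = v then constantCoeff φ else 0 := by
  classical
  rw [X_def, coeff_mul_monomial, mul_one]
  by_cases h : i = v
  · subst h
    rw [if_pos le_rfl, if_pos rfl, tsub_self, coeff_zero_eq_constantCoeff_apply]
  · rw [if_neg, if_neg h]
    intro hle
    have := hle v
    simp [h] at this

/-! ## Move two on `G_γ` -/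

section MoveTwo

variable [CharP k 2] (γ : k) (hγ : γ ≠ 0)
include hγ

/-- MOVE TWO: the identity `G_γ ∘ θ₂ = X² + γ⁻² V³ + γ t³`, the legality of `θ₂`, and the win.  Packaged as ONE existence
statement: a legal move `(θ₂, w₂ = (0,3,2,0,0,2))` with `G_γ ∘ θ₂` equal to a `w₂`-homogeneous polynomial germ whose cone is
smooth off the vertex directions. [OURS · L1 W4.3] -/
theorem exists_moveTwo_g5Successor :
    ∃ θ : Fin 6 → MvPowerSeries (Fin 6) k, CobordantGame.IsMove k θ ![0, 3, 2, 0, 0, 2] ∧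
      subst θ (X 1 ^ 2 + X 2 * X 3 ^ 4 + X 2 ^ 3 * (C γ + X 4) ^ 4 + (C γ + X 4) * X 5 ^ 3 : MvPowerSeries (Fin 6) k) =
        X 1 ^ 2 + C (γ⁻¹ ^ 2) * X 2 ^ 3 + C γ * X 5 ^ 3 := by
  classical
  haveI : CharP (MvPowerSeries (Fin 6) k) 2 := charP_of_injective_ringHom C_injective 2
  have h2 : (2 : MvPowerSeries (Fin 6) k) = 0 := CharP.ofNat_eq_zero _ 2
  -- the Hensel cube root `μ³ = 1 + γ⁻¹ S` in `k⟦S⟧`, its inverse, embedded along `S = X 4`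
  have h3 : ((3 : ℕ) : k) ≠ 0 := by
    rw [show ((3 : ℕ) : k) = 2 + 1 by norm_num, CharP.ofNat_eq_zero k 2, zero_add]; exact one_ne_zero
  obtain ⟨μ, hμ3, hμ0⟩ := exists_pow_eq_one_add_C_mul_X (k := k) 3 h3 γ⁻¹
  set m : MvPowerSeries (Fin 6) k := embAt 4 μ with hm
  set mi : MvPowerSeries (Fin 6) k := embAt 4 μ⁻¹ with hmi
  have hmmi : m * mi = 1 := by
    rw [hm, hmi, ← embAt_mul, PowerSeries.mul_inv_cancel μ (by rw [hμ0]; exact one_ne_zero), embAt_one]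
  have hcmi : constantCoeff mi = 1 := by
    rw [hmi, constantCoeff_embAt, PowerSeries.constantCoeff_inv, hμ0, inv_one]
  have hγγ : (C γ : MvPowerSeries (Fin 6) k) * C γ⁻¹ = 1 := by rw [← map_mul, mul_inv_cancel₀ hγ, map_one]
  have hβ : (C γ + X 4 : MvPowerSeries (Fin 6) k) = C γ * m ^ 3 := by
    rw [hm, ← embAt_pow, hμ3, embAt_add, embAt_one, embAt_mul, embAt_C, embAt_X, mul_add, mul_one, ← mul_assoc, hγγ,
      one_mul]
  -- the move
  set θ : Fin 6 → MvPowerSeries (Fin 6) k := ![X 0, X 1 + C γ⁻¹ * mi * X 3 * X 2,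
    C (γ⁻¹ ^ 2) * mi ^ 4 * X 2 + C (γ⁻¹ ^ 2) * mi ^ 6 * X 3 * X 3, X 3, X 4, mi * X 5] with hθ
  have hθ0 : θ 0 = X 0 := rfl
  have hθ1 : θ 1 = X 1 + C γ⁻¹ * mi * X 3 * X 2 := rfl
  have hθ2 : θ 2 = C (γ⁻¹ ^ 2) * mi ^ 4 * X 2 + C (γ⁻¹ ^ 2) * mi ^ 6 * X 3 * X 3 := rfl
  have hθ3 : θ 3 = X 3 := rfl
  have hθ4 : θ 4 = X 4 := rfl
  have hθ5 : θ 5 = mi * X 5 := rfl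
  have hθcc : ∀ i, constantCoeff (θ i) = 0 := by
    intro i
    fin_cases i
    · simp [hθ0, constantCoeff_X]
    · simp [hθ1, constantCoeff_X]
    · simp [hθ2, constantCoeff_X]
    · simp [hθ3, constantCoeff_X]
    · simp [hθ4, constantCoeff_X]
    · simp [hθ5, constantCoeff_X]
  have hθs : HasSubst θ := hasSubst_of_constantCoeff_zero hθcc
  refine ⟨θ, ⟨hθcc, ?_, ⟨1, by simp⟩⟩, ?_⟩
  · -- the linear part is the diagonal matrix `diag(1, 1, γ⁻², 1, 1, 1)`
    have hXX : ∀ j a : Fin 6, coeff (Finsupp.single j 1) (X a : MvPowerSeries (Fin 6) k) =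
        if j = a then 1 else 0 := fun j a => by
      rw [coeff_X]
      by_cases h : j = a
      · subst h; simp
      · rw [if_neg, if_neg h]
        exact fun h' => h ((Finsupp.single_left_inj one_ne_zero).mp h')
    have hr0 : ∀ j : Fin 6, coeff (Finsupp.single j 1) (θ 0) = if j = 0 then 1 else 0 := fun j => by
      rw [hθ0, hXX]
    have hr1 : ∀ j : Fin 6, coeff (Finsupp.single j 1) (θ 1) = if j = 1 then 1 else 0 := fun j => by
      rw [hθ1, map_add, hXX, coeff_single_one_mul_eq_zero _ _ (by simp [constantCoeff_X]) (constantCoeff_X _), add_zero]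
    have hr2 : ∀ j : Fin 6, coeff (Finsupp.single j 1) (θ 2) = if j = 2 then γ⁻¹ ^ 2 else 0 := fun j => by
      rw [hθ2, map_add, coeff_single_one_mul_X, coeff_single_one_mul_eq_zero _ _ (by simp [constantCoeff_X])
        (constantCoeff_X _), add_zero]
      simp [hcmi]
    have hr3 : ∀ j : Fin 6, coeff (Finsupp.single j 1) (θ 3) = if j = 3 then 1 else 0 := fun j => by
      rw [hθ3, hXX]
    have hr4 : ∀ j : Fin 6, coeff (Finsupp.single j 1) (θ 4) = if j = 4 then 1 else 0 := fun j => by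
      rw [hθ4, hXX]
    have hr5 : ∀ j : Fin 6, coeff (Finsupp.single j 1) (θ 5) = if j = 5 then 1 else 0 := fun j => by
      rw [hθ5, coeff_single_one_mul_X, hcmi]
    have hM : (Matrix.of fun i j : Fin 6 => coeff (Finsupp.single j 1) (θ i)) =
        Matrix.diagonal ![(1 : k), 1, γ⁻¹ ^ 2, 1, 1, 1] := by
      ext i j
      rw [Matrix.of_apply, Matrix.diagonal_apply]
      fin_cases i
      · fin_cases j <;> simp [hr0]
      · fin_cases j <;> simp [hr1]
      · fin_cases j <;> simp [hr2]
      · fin_cases j <;> simp [hr3]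
      · fin_cases j <;> simp [hr4]
      · fin_cases j <;> simp [hr5]
    rw [hM, Matrix.det_diagonal]
    simp [Fin.prod_univ_succ, hγ]
  · -- the identity
    simp only [subst_add hθs, subst_mul hθs, subst_pow hθs, subst_X hθs, subst_C]
    rw [hθ1, hθ2, hθ3, hθ4, hθ5, hβ]
    -- abbreviations
    set x1 : MvPowerSeries (Fin 6) k := X 1
    set x2 : MvPowerSeries (Fin 6) k := X 2
    set x3 : MvPowerSeries (Fin 6) k := X 3
    set x5 : MvPowerSeries (Fin 6) k := X 5
    set cg : MvPowerSeries (Fin 6) k := C γ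
    set ci : MvPowerSeries (Fin 6) k := C γ⁻¹
    have hci2 : (C (γ⁻¹ ^ 2) : MvPowerSeries (Fin 6) k) = ci ^ 2 := map_pow _ _ _
    rw [hci2]
    -- (1) the square
    have hsq : (x1 + ci * mi * x3 * x2) ^ 2 = x1 ^ 2 + ci ^ 2 * mi ^ 2 * x3 ^ 2 * x2 ^ 2 := by
      linear_combination (x1 * ci * mi * x3 * x2) * h2
    -- (2) `β² u + Z²` after the move is `m² V`
    set U : MvPowerSeries (Fin 6) k := ci ^ 2 * mi ^ 4 * x2 + ci ^ 2 * mi ^ 6 * x3 * x3 with hU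
    have hW : (cg * m ^ 3) ^ 2 * U + x3 ^ 2 = m ^ 2 * x2 := by
      rw [hU]
      linear_combination (m ^ 2 * x2 * (cg * ci + 1) * (m * mi) ^ 4 + x3 ^ 2 * (cg * ci + 1) * (m * mi) ^ 6) * hγγ
        + (m ^ 2 * x2 * ((m * mi) ^ 3 + (m * mi) ^ 2 + m * mi + 1)
          + x3 ^ 2 * ((m * mi) ^ 5 + (m * mi) ^ 4 + (m * mi) ^ 3 + (m * mi) ^ 2 + m * mi + 1)) * hmmi
        + (x3 ^ 2) * h2
    -- (3) Frobenius on the `u`-terms: `u X3⁴ + u³ β⁴ = u (β² u + X3²)²`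
    have hF : U * x3 ^ 4 + U ^ 3 * (cg * m ^ 3) ^ 4 = U * ((cg * m ^ 3) ^ 2 * U + x3 ^ 2) ^ 2 := by
      linear_combination (-(U ^ 2 * (cg * m ^ 3) ^ 2 * x3 ^ 2)) * h2
    -- (4) the cube
    have hT : cg * m ^ 3 * (mi * x5) ^ 3 = cg * x5 ^ 3 := by
      linear_combination (cg * x5 ^ 3 * ((m * mi) ^ 2 + m * mi + 1)) * hmmi
    -- assemble
    have hmain : U * (m ^ 2 * x2) ^ 2 = ci ^ 2 * x2 ^ 3 + ci ^ 2 * mi ^ 2 * x3 ^ 2 * x2 ^ 2 := by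
      rw [hU]
      linear_combination (ci ^ 2 * x2 ^ 3 * ((m * mi) ^ 3 + (m * mi) ^ 2 + m * mi + 1)
        + ci ^ 2 * mi ^ 2 * x3 ^ 2 * x2 ^ 2 * ((m * mi) ^ 3 + (m * mi) ^ 2 + m * mi + 1)) * hmmi
    calc (x1 + ci * mi * x3 * x2) ^ 2 + U * x3 ^ 4 + U ^ 3 * (cg * m ^ 3) ^ 4 + cg * m ^ 3 * (mi * x5) ^ 3
        = (x1 + ci * mi * x3 * x2) ^ 2 + (U * x3 ^ 4 + U ^ 3 * (cg * m ^ 3) ^ 4) + cg * m ^ 3 * (mi * x5) ^ 3 := by ring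
      _ = x1 ^ 2 + ci ^ 2 * mi ^ 2 * x3 ^ 2 * x2 ^ 2 + U * (m ^ 2 * x2) ^ 2 + cg * x5 ^ 3 := by rw [hsq, hF, hW, hT]
      _ = x1 ^ 2 + ci ^ 2 * x2 ^ 3 + cg * x5 ^ 3 := by
          rw [hmain]; linear_combination (ci ^ 2 * mi ^ 2 * x3 ^ 2 * x2 ^ 2) * h2

/-- THE SINGULAR FIRST-MOVE SUCCESSORS OF `g₅` ARE WON IN ONE MORE MOVE (char 2, every field, `γ ≠ 0`). [OURS · L1 W4.3] -/
theorem won_g5Successor :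
    CobordantGame.Won k 6 (X 1 ^ 2 + X 2 * X 3 ^ 4 + X 2 ^ 3 * (C γ + X 4) ^ 4 + (C γ + X 4) * X 5 ^ 3 :
      MvPowerSeries (Fin 6) k) := by
  classical
  obtain ⟨θ, hmove, hθ⟩ := exists_moveTwo_g5Successor γ hγ
  set w : Fin 6 → ℕ := ![0, 3, 2, 0, 0, 2] with hw
  set P : MvPolynomial (Fin 6) k := MvPolynomial.X 1 ^ 2 + MvPolynomial.C (γ⁻¹ ^ 2) * MvPolynomial.X 2 ^ 3 +
    MvPolynomial.C γ * MvPolynomial.X 5 ^ 3 with hPdef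
  have hcoe : (P : MvPowerSeries (Fin 6) k) = X 1 ^ 2 + C (γ⁻¹ ^ 2) * X 2 ^ 3 + C γ * X 5 ^ 3 := by
    simp [hPdef, MvPolynomial.coe_add, MvPolynomial.coe_mul, MvPolynomial.coe_pow, MvPolynomial.coe_X, MvPolynomial.coe_C]
  have hw1 : w 1 = 3 := rfl
  have hw2 : w 2 = 2 := rfl
  have hw5 : w 5 = 2 := rfl
  have hP : P.IsWeightedHomogeneous w 6 := by
    have h1 := MvPolynomial.isWeightedHomogeneous_X (R := k) w 1
    have h2' := MvPolynomial.isWeightedHomogeneous_X (R := k) w 2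
    have h5 := MvPolynomial.isWeightedHomogeneous_X (R := k) w 5
    rw [hw1] at h1; rw [hw2] at h2'; rw [hw5] at h5
    have hA : (MvPolynomial.X 1 ^ 2 : MvPolynomial (Fin 6) k).IsWeightedHomogeneous w (2 • 3) := h1.pow 2
    have hB : (MvPolynomial.C (γ⁻¹ ^ 2) * MvPolynomial.X 2 ^ 3 : MvPolynomial (Fin 6) k).IsWeightedHomogeneous w (3 • 2) :=
      (h2'.pow 3).C_mul _
    have hC : (MvPolynomial.C γ * MvPolynomial.X 5 ^ 3 : MvPolynomial (Fin 6) k).IsWeightedHomogeneous w (3 • 2) :=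
      (h5.pow 3).C_mul _
    have e1 : (2 • 3 : ℕ) = 6 := rfl
    have e2 : (3 • 2 : ℕ) = 6 := rfl
    rw [e1] at hA; rw [e2] at hB hC
    rw [hPdef]
    exact (hA.add hB).add hC
  have hP0 : P ≠ 0 := by
    intro h0
    have := congrArg (fun Q : MvPolynomial (Fin 6) k => (Q : MvPowerSeries (Fin 6) k)) h0
    simp only [hcoe, MvPolynomial.coe_zero] at this
    have h2 := congrArg (coeff (Finsupp.single (1 : Fin 6) 2)) this
    rw [map_add, map_add, coeff_X_pow, if_pos rfl,
      X_dvd_iff.mp ((dvd_pow_self (X 2 : MvPowerSeries (Fin 6) k) (by norm_num)).mul_left _) _ (by simp),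
      X_dvd_iff.mp ((dvd_pow_self (X 5 : MvPowerSeries (Fin 6) k) (by norm_num)).mul_left _) _ (by simp),
      map_zero] at h2
    simp at h2
  have h3 : (3 : k) ≠ 0 := by
    rw [show (3 : k) = 2 + 1 by norm_num, CharP.ofNat_eq_zero k 2, zero_add]; exact one_ne_zero
  have hcone : ∀ c : Fin 6 → k, (∀ i, w i = 0 → c i = 0) → MvPolynomial.eval c P = 0 →
      (∀ i, MvPolynomial.eval c (MvPolynomial.pderiv i P) = 0) → c = 0 := by
    intro c hc0 hPc hD
    have hc2 : c 2 = 0 := by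
      have := hD 2
      rw [hPdef] at this
      simp only [map_add, map_mul, map_pow, Derivation.leibniz, Derivation.leibniz_pow, MvPolynomial.pderiv_X,
        MvPolynomial.pderiv_C, MvPolynomial.eval_X, MvPolynomial.eval_C, smul_eq_mul] at this
      simpa [hγ, h3] using this
    have hc5 : c 5 = 0 := by
      have := hD 5
      rw [hPdef] at this
      simp only [map_add, map_mul, map_pow, Derivation.leibniz, Derivation.leibniz_pow, MvPolynomial.pderiv_X,
        MvPolynomial.pderiv_C, MvPolynomial.eval_X, MvPolynomial.eval_C, smul_eq_mul] at this
      simpa [hγ, h3] using this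
    have hc1 : c 1 = 0 := by
      rw [hPdef] at hPc
      simp only [map_add, map_mul, map_pow, MvPolynomial.eval_X, MvPolynomial.eval_C] at hPc
      simpa [hc2, hc5] using hPc
    funext i
    fin_cases i
    · exact hc0 0 rfl
    · exact hc1
    · exact hc2
    · exact hc0 3 rfl
    · exact hc0 4 rfl
    · exact hc5
  refine CobordantGame.Won.move θ w hmove fun g hg => ?_
  obtain ⟨c, e, hoff, hfac, hndvd, hsing⟩ := hg
  rw [hθ, ← hcoe] at hfac
  have hfac' : subst (fun i : Fin 6 => if 0 < w i then
      X (0 : Fin (6 + 1)) ^ (w i) * (C (c i) + X i.succ) else X i.succ)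
      (subst (X : Fin 6 → MvPowerSeries (Fin 6) k) (P : MvPowerSeries (Fin 6) k)) = X 0 ^ e * g := by
    rw [MvPowerSeries.subst_self]
    exact hfac
  exact absurd hsing (crux_move_wins_of_isWeightedHomogeneous_offVertex w hP hP0 hcone c hoff e g hfac' hndvd)

end MoveTwo

/-- §4 R2-4 — CARD A WINS `g₅` IN TWO MOVES: the honest 5-variable wild specimen `g₅ = X² + uZ⁴ + u³S⁴ + S t³` (`0 = X, 1 = u,
2 = Z, 3 = S, 4 = t`) is WON: saturated centre `V(X,Z,S,t) ⊇ u`-axis with weights `(2,0,1,1,1)`; its singular successors are the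
`G_γ` at the `S`-axis points (`…G5MoveOne`), each won by the characteristic-2 move `θ₂` with weights `(3,2,2)` on `(X, V, t)`
(`won_g5Successor`).  Char `2`, every field (the sketch's `[IsAlgClosed k]` is not needed). [OURS · L1 W4.3, Sketch-L1-idea-1
v4 §4 R2-4] -/
theorem won_g5 [CharP k 2] :
    CobordantGame.Won k 5 (X 0 ^ 2 + X 1 * X 2 ^ 4 + X 1 ^ 3 * X 3 ^ 4 + X 3 * X 4 ^ 3 : MvPowerSeries (Fin 5) k) := by
  refine CobordantGame.Won.move MvPowerSeries.X ![2, 0, 1, 1, 1] (isMove_X _ ⟨0, by simp⟩) fun g hg => ?_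
  obtain ⟨γ, hγ, rfl⟩ := g5_isSuccessor_classification g hg
  exact won_g5Successor γ hγ

end GradedGame

end Summit.ResolutionOfSingularities.ResolutionOfSingularities.Theorems
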